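import Mathlib.Geometry.Manifold.Diffeomorph
import Mathlib.Geometry.Manifold.Instances.Real
import Literature.Geometry.Lorentzian.Basic
import Literature.Geometry.Lorentzian.LorentzianMetric
import Literature.Geometry.Lorentzian.Einstein
import Literature.Geometry.Lorentzian.Causality
import Literature.Geometry.Lorentzian.Hypersurface
import Literature.Geometry.Lorentzian.InitialData
import Literature.Geometry.Lorentzian.AsymptoticFlatness
import Literature.Geometry.Lorentzian.KerrSchild
import HarnessLib

/-!
# Stationary vacuum trumpet models and their Kerr–Schild embeddings

A *trumpet slice* of a black-hole spacetime is a stationary spacelike slice which, instead of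
crossing the singular interior or a second asymptotically flat end, descends an infinitely long
cylinder inside the hole: the lapse of the stationary slicing vanishes down the cylinder, the
slice is complete, and it has one asymptotically flat end. Sources: Hannam–Husa–Ohme–Brügmann–Ó
Murchadha, Phys. Rev. D 78 (2008) 064020, §II.C (the maximal trumpet of Schwarzschild:
`C = 3√3 M²/4`, `R > 3M/2`, `α = (1 - 2M/R + C²/R⁴)^{1/2} → 0` at the limiting cylinder
`R = 3M/2`); Baumgarte–Naculich, Phys. Rev. D 75 (2007) 067502 (its closed form); Beig–Ó
Murchadha, Phys. Rev. D 57 (1998) 4728 (late-time approach of the maximal foliation to it);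
Dennison–Baumgarte–Montero, Phys. Rev. Lett. 113 (2014) 261101 (stationary trumpet slices of
Kerr; the trumpet surface lies between the inner and the outer horizon).

Over the Kerr–Schild chart calculus of `E4 = ℝ⁴` (time index `0`, `∂₀ = E4.basisVector 0`):

* `IsTrumpetModel U γ` — an **`x⁰`-stationary vacuum trumpet model**: `U ⊆ ℝ⁴` open and
  invariant under `x ↦ x + s ∂₀` (`IsTimeInvariantDomain`), `γ` a `C^∞` Lorentzian metric on `U`
  with `x⁰`-independent components (`IsStationaryInChart`), Ricci-flat, `γ(∂₀, ∂₀)` bounded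
  above, whose slab `V = {y | (0, y) ∈ U} ≅ ℝ³ ∖ {0}` carries a unit normal `νV` and induced data
  `DV` forming a complete maximal initial data set, asymptotically flat of order `1` at an end
  `e` where the model lapse `N = -γ(∂₀, νV) → 1`, with `N > 0`, `N → 0` off `e` outside compact
  sets (down the trumpet), and the small-lapse region causally unable to reach the world tube
  over the far part of `e` for every time orientation making `νV` future (`IsTrumpetSlab`).
* `IsKerrEmbeddedStationaryWith M a U γ` / `IsKerrEmbeddedStationary U γ` — `(U, γ)` **embeds
  time-equivariantly into (sub-extremal) Kerr–Schild Kerr**: a smooth injective `χ : U → ℝ⁴`,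
  `χ(U) ⊆ {r > 0} = Kerr.region a 0`, `χ(U) ⊇ Kerr.region a r₁` for some `r₁ < r₊(M, a)`,
  `χ^* g_{M,a} = γ` (`Kerr.bilin M a`) and `χ (x + s ∂₀) = χ x + (c s) ∂₀` with `c > 0`.

## Design

The bodies are, clause for clause, the hypothesis and the conclusion of the statement items
`TrumpetKIDRigidity` / `KerrTrumpetModel` / `SliceDictionary` of the route `LapseTrumpetKID`
(summit `FinalStateConjecture`), so that those items restate *definitionally* (`Iff.rfl`):
`TrumpetKIDRigidity` is `∀ U γ, IsTrumpetModel U γ → IsKerrEmbeddedStationary U γ`,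
`KerrTrumpetModel` is `∀ M a, Kerr.IsSubextremal M a → ∃ U γ, IsTrumpetModel U γ ∧
IsKerrEmbeddedStationaryWith M a U γ`; the unfolding lemmas `isTrumpetModel_iff`,
`isKerrEmbeddedStationary_iff` display the inline forms. Hence plain `def`s (conjunctions) with
named projections, not structures. Imports stay inside that route's cone; nothing here is a
named fact. NOT here: any existence statement (that Schwarzschild or Kerr admits such a model
is the content of the cited papers and of the route item `KerrTrumpetModel`), any rigidity
statement, and no claim that the Dennison–Baumgarte–Montero slices are maximal (maximality of
the slab is a clause because the route works in maximal gauge, after Beig–Ó Murchadha).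
-/

noncomputable section

open Manifold Bundle TopologicalSpace Filter Set Function
open scoped ContDiff Topology

namespace Literature.Geometry.Lorentzian

/-! ### Time-invariant chart domains and `x⁰`-stationary metrics -/

/-- The open set `U ⊆ ℝ⁴` is **invariant under time translations** `x ↦ x + s ∂₀`
(`∂₀ = E4.basisVector 0`), i.e. it is a union of complete `x⁰`-coordinate lines: the natural
domain of an `x⁰`-stationary chart. [folklore] -/
def IsTimeInvariantDomain (U : Opens E4) : Prop :=
  ∀ x ∈ (U : Set E4), ∀ s : ℝ, x + s • E4.basisVector 0 ∈ (U : Set E4)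

namespace IsTimeInvariantDomain

variable {U : Opens E4}

/-- A time-invariant domain contains `x - s ∂₀` with `x`. [folklore] -/
theorem sub_smul_mem (hU : IsTimeInvariantDomain U) {x : E4} (hx : x ∈ (U : Set E4)) (s : ℝ) :
    x - s • E4.basisVector 0 ∈ (U : Set E4) := by
  simpa [sub_eq_add_neg, neg_smul] using hU x hx (-s)

/-- Membership in a time-invariant domain is invariant under time translation. [folklore] -/
theorem add_smul_mem_iff (hU : IsTimeInvariantDomain U) (x : E4) (s : ℝ) :
    x + s • E4.basisVector 0 ∈ (U : Set E4) ↔ x ∈ (U : Set E4) := by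
  refine ⟨fun h ↦ ?_, fun h ↦ hU x h s⟩
  simpa using hU.sub_smul_mem h s

/-- The time translate `x + s ∂₀` of a point of a time-invariant domain. [folklore] -/
def translate (hU : IsTimeInvariantDomain U) (x : U) (s : ℝ) : U :=
  ⟨(x : E4) + s • E4.basisVector 0, hU x x.2 s⟩

/-- Coordinates of the time translate. [folklore] -/
@[simp]
theorem coe_translate (hU : IsTimeInvariantDomain U) (x : U) (s : ℝ) :
    (hU.translate x s : E4) = (x : E4) + s • E4.basisVector 0 :=
  rfl

end IsTimeInvariantDomain

/-- All of `ℝ⁴` is a time-invariant domain. [folklore] -/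
theorem isTimeInvariantDomain_top : IsTimeInvariantDomain (⊤ : Opens E4) :=
  fun _ _ _ ↦ trivial

/-- Every Kerr–Schild chart domain `Kerr.region a r₀ = {max r₀ 0 < r(a, x)}` is a time-invariant
domain: the Kerr–Schild radius `r(a, x)` depends on the spatial coordinates only
(Dafermos–Rodnianski arXiv:0811.0354, §5.1, the `t*`-translations `φ_τ`).
[cite: arXiv08110354, §5.1] -/
theorem Kerr.isTimeInvariantDomain_region (a r₀ : ℝ) :
    IsTimeInvariantDomain (Kerr.region a r₀) := by
  intro x hx s
  have h3 : (x + s • E4.basisVector 0) 3 = x 3 := by simp [E4.basisVector]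
  have hsp : E4.spatial (E4.basisVector 0) = 0 := by
    ext i
    simp [E4.spatial_apply, E4.basisVector, Fin.succ_ne_zero]
  have hn : E4.spatialNorm (x + s • E4.basisVector 0) = E4.spatialNorm x := by
    simp [E4.spatialNorm, map_add, map_smul, hsp]
  rw [SetLike.mem_coe, Kerr.mem_region] at hx ⊢
  simpa only [Kerr.radius, hn, h3] using hx

/-- The Lorentzian metric `γ` on the chart domain `U ⊆ ℝ⁴` is **`x⁰`-stationary**: its
components in the Cartesian frame of `ℝ⁴` are invariant under time translation, i.e.
`γ_y(v, w) = γ_x(v, w)` whenever `y = x + s ∂₀` (both in `U`). Equivalently `∂₀` is a Killing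
field of `γ` expressed in a chart adapted to it (O'Neill 1983, Ch. 9, Prop. 9.23 ff.; for the
Kerr–Schild form of Kerr, Dafermos–Rodnianski arXiv:0811.0354, §5.1). [folklore] -/
def IsStationaryInChart (U : Opens E4) (γ : LorentzianMetric 𝓘(ℝ, E4) (⊤ : ℕ∞) U) : Prop :=
  ∀ (x y : U) (s : ℝ), (y : E4) = (x : E4) + s • E4.basisVector 0 → ∀ v w : E4,
    γ.val y v w = γ.val x v w

namespace IsStationaryInChart

variable {U : Opens E4} {γ : LorentzianMetric 𝓘(ℝ, E4) (⊤ : ℕ∞) U}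

/-- The components of an `x⁰`-stationary metric agree at time-translated points. [folklore] -/
theorem val_eq (h : IsStationaryInChart U γ) {x y : U} {s : ℝ}
    (hy : (y : E4) = (x : E4) + s • E4.basisVector 0) (v w : E4) : γ.val y v w = γ.val x v w :=
  h x y s hy v w

/-- The components of an `x⁰`-stationary metric are invariant under the time translations of a
time-invariant domain. [folklore] -/
theorem val_translate (h : IsStationaryInChart U γ) (hU : IsTimeInvariantDomain U) (x : U)
    (s : ℝ) (v w : E4) : γ.val (hU.translate x s) v w = γ.val x v w :=
  h x (hU.translate x s) s rfl v w

end IsStationaryInChart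

/-! ### Trumpet slabs and trumpet models -/

/-- The **trumpet slab** clauses of an `x⁰`-stationary model `(U, γ)`: `V ⊆ ℝ³` is the slab
`{y | (0, y) ∈ U}`, `σ : V → U` the slice map `y ↦ (0, y)`, `νV` a unit timelike normal field
along `σ`, `DV` an initial data set on `V` and `e` an asymptotically flat end of `V`, such that:
the induced metric and second fundamental form of `σ` (w.r.t. `νV`) are those of `DV`; `DV` is
maximal (`tr k = 0`) and complete; `V ≅ ℝ³ ∖ {0}` (one puncture); `DV` is asymptotically flat of
order `1` at `e`; the **model lapse** `N = -γ(∂₀, νV)` is positive, tends to `1` at the end `e`,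
and tends to `0` off `e` outside compact sets (the slab descends the trumpet); and **the lapse
well is trapped**: for some `ε > 0` and `R'`, for every time orientation of `γ` making `νV`
future-directed, no point of the slab with `N < ε` can be joined by a future causal curve to the
world tube `{σ z + s ∂₀ | z ∈ e.far R'}` over the far part of the end. This is the geometry of the
maximal trumpet slice of Schwarzschild (`R > 3M/2`, `α → 0` at the limiting cylinder `R = 3M/2`,
`α → 1` at infinity) abstracted from Hannam–Husa–Ohme–Brügmann–Ó Murchadha 2008, §II.C (with
Beig–Ó Murchadha 1998 for the maximal gauge); the causal-trapping clause encodes that the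
cylinder lies inside the black hole. [cite: HannamEtAl2008, §II.C] -/
def IsTrumpetSlab (U : Opens E4) (γ : LorentzianMetric 𝓘(ℝ, E4) (⊤ : ℕ∞) U) (V : Opens E3)
    (σ : V → U) (νV : NormalField 𝓘(ℝ, E4) σ) (DV : InitialDataSet (𝓡 3) V) (e : AFEnd V) :
    Prop :=
  (V : Set E3) = {y | E4.ofTimeSpace 0 y ∈ (U : Set E4)} ∧ (∀ y, (σ y : E4) = E4.ofTimeSpace 0 y) ∧
    γ.toPseudoRiemannianMetric.IsUnitNormal (𝓡 3) σ νV (-1) ∧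
    (∀ (y : V) (v w : TangentSpace (𝓡 3) y), DV.h.inner y v w =
      γ.val (σ y) (mfderiv (𝓡 3) 𝓘(ℝ, E4) σ y v) (mfderiv (𝓡 3) 𝓘(ℝ, E4) σ y w)) ∧
    (∀ [γ.toPseudoRiemannianMetric.HasLeviCivita] (y : V),
      γ.toPseudoRiemannianMetric.secondFundamentalForm (𝓡 3) σ νV y = DV.kBilin y) ∧
    DV.IsMaximalData ∧ (∀ [DV.metric.HasLeviCivita], DV.IsComplete) ∧
    Nonempty (Diffeomorph (𝓡 3) (𝓡 3) V ((⟨({0} : Set E3)ᶜ, isOpen_compl_singleton⟩ : Opens E3))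
      (⊤ : ℕ∞)) ∧
    e.IsAsymptoticallyFlat DV 1 ∧ (∀ y : V, 0 < - γ.val (σ y) (E4.basisVector 0) (νV y)) ∧
    Tendsto (fun z : exteriorRegion e.R ↦
        - γ.val (σ (e.dataChart z)) (E4.basisVector 0) (νV (e.dataChart z)))
      (comap (fun z : exteriorRegion e.R ↦ ‖(z : E3)‖) atTop) (𝓝 1) ∧
    (∀ ε : ℝ, 0 < ε → ∃ K : Set V, IsCompact K ∧ ∀ y : V, y ∉ K → y ∉ (e.U : Set V) →
      - γ.val (σ y) (E4.basisVector 0) (νV y) < ε) ∧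
    (∃ ε : ℝ, 0 < ε ∧ ∃ R' : ℝ, ∀ τU : TimeOrientation γ, (∀ y : V, τU.IsFutureDirected (νV y)) →
      ∀ y : V, - γ.val (σ y) (E4.basisVector 0) (νV y) < ε → ∀ p : U,
        (∃ (z : V) (s : ℝ), z ∈ e.far R' ∧ (p : E4) = (σ z : E4) + s • E4.basisVector 0) →
          p ∉ γ.causalFuture τU {σ y})

/-- An **`x⁰`-stationary vacuum trumpet model**: an open `U ⊆ ℝ⁴` invariant under
`x ↦ x + s ∂₀` and a `C^∞` Lorentzian metric `γ` on `U` with `x⁰`-independent components,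
Ricci-flat (for the Levi-Civita connection of `γ`), with `γ(∂₀, ∂₀)` bounded above on `U`, whose
slab `{x⁰ = 0}` is a trumpet slab (`IsTrumpetSlab`: a complete, maximal, one-punctured,
asymptotically flat slice with positive lapse tending to `1` at the flat end and to `0` down the
trumpet, the lapse well being causally trapped). Informally: the Killing development of a
trumpet Killing initial data set — the stationary end-state geometry of a black hole in a
singularity-avoiding stationary slicing (Hannam–Husa–Ohme–Brügmann–Ó Murchadha 2008, §II.C, the
maximal trumpet `R ≥ 3M/2` of Schwarzschild; Dennison–Baumgarte–Montero 2014 for Kerr). The body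
is verbatim the hypothesis of the route items `TrumpetKIDRigidity` / `KerrTrumpetModel`
(`isTrumpetModel_iff`). [cite: HannamEtAl2008, §II.C] -/
def IsTrumpetModel (U : Opens E4) (γ : LorentzianMetric 𝓘(ℝ, E4) (⊤ : ℕ∞) U) : Prop :=
  IsTimeInvariantDomain U ∧ IsStationaryInChart U γ ∧
    (∀ [γ.toPseudoRiemannianMetric.HasLeviCivita], γ.toPseudoRiemannianMetric.IsRicciFlat) ∧
    (∃ C : ℝ, ∀ x : U, γ.val x (E4.basisVector 0) (E4.basisVector 0) ≤ C) ∧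
    ∃ (V : Opens E3) (σ : V → U) (νV : NormalField 𝓘(ℝ, E4) σ) (DV : InitialDataSet (𝓡 3) V)
      (e : AFEnd V), IsTrumpetSlab U γ V σ νV DV e

/-- Unfolding lemma: `IsTrumpetModel U γ` is, definitionally, the inline hypothesis block of the
route items `TrumpetKIDRigidity` and `KerrTrumpetModel` of route `LapseTrumpetKID`
(summit `FinalStateConjecture`), clause for clause. [folklore] -/
theorem isTrumpetModel_iff (U : Opens E4) (γ : LorentzianMetric 𝓘(ℝ, E4) (⊤ : ℕ∞) U) :
    IsTrumpetModel U γ ↔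
    ((∀ x ∈ (U : Set E4), ∀ s : ℝ, x + s • E4.basisVector 0 ∈ (U : Set E4)) ∧ (∀ (x y : U) (s : ℝ),
      (y : E4) = (x : E4) + s • E4.basisVector 0 → ∀ v w : E4, γ.val y v w = γ.val x v w) ∧ (∀
      [γ.toPseudoRiemannianMetric.HasLeviCivita], γ.toPseudoRiemannianMetric.IsRicciFlat) ∧
      (∃ C : ℝ, ∀ x : U, γ.val x (E4.basisVector 0) (E4.basisVector 0) ≤ C) ∧ ∃ (V : Opens E3)
      (σ : V → U) (νV : NormalField 𝓘(ℝ, E4) σ) (DV : InitialDataSet (𝓡 3) V) (e : AFEnd V),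
      (V : Set E3) = {y | E4.ofTimeSpace 0 y ∈ (U : Set E4)} ∧ (∀ y, (σ y : E4) =
      E4.ofTimeSpace 0 y) ∧ γ.toPseudoRiemannianMetric.IsUnitNormal (𝓡 3) σ νV (-1) ∧ (∀ (y : V)
      (v w : TangentSpace (𝓡 3) y), DV.h.inner y v w = γ.val (σ y) (mfderiv (𝓡 3) 𝓘(ℝ, E4) σ y v)
      (mfderiv (𝓡 3) 𝓘(ℝ, E4) σ y w)) ∧ (∀ [γ.toPseudoRiemannianMetric.HasLeviCivita] (y : V),
      γ.toPseudoRiemannianMetric.secondFundamentalForm (𝓡 3) σ νV y = DV.kBilin y) ∧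
      DV.IsMaximalData ∧ (∀ [DV.metric.HasLeviCivita], DV.IsComplete) ∧ Nonempty (Diffeomorph
      (𝓡 3) (𝓡 3) V ((⟨({0} : Set E3)ᶜ, isOpen_compl_singleton⟩ : Opens E3)) (⊤ : ℕ∞)) ∧
      e.IsAsymptoticallyFlat DV 1 ∧ (∀ y : V, 0 < - γ.val (σ y) (E4.basisVector 0) (νV y)) ∧
      Tendsto (fun z : exteriorRegion e.R ↦ - γ.val (σ (e.dataChart z)) (E4.basisVector 0)
      (νV (e.dataChart z))) (comap (fun z : exteriorRegion e.R ↦ ‖(z : E3)‖) atTop) (𝓝 1) ∧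
      (∀ ε : ℝ, 0 < ε → ∃ K : Set V, IsCompact K ∧ ∀ y : V, y ∉ K → y ∉ (e.U : Set V) →
      - γ.val (σ y) (E4.basisVector 0) (νV y) < ε) ∧ (∃ ε : ℝ, 0 < ε ∧ ∃ R' : ℝ,
      ∀ τU : TimeOrientation γ, (∀ y : V, τU.IsFutureDirected (νV y)) → ∀ y : V,
      - γ.val (σ y) (E4.basisVector 0) (νV y) < ε → ∀ p : U, (∃ (z : V) (s : ℝ), z ∈ e.far R' ∧
      (p : E4) = (σ z : E4) + s • E4.basisVector 0) → p ∉ γ.causalFuture τU {σ y})) :=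
  Iff.rfl

namespace IsTrumpetModel

variable {U : Opens E4} {γ : LorentzianMetric 𝓘(ℝ, E4) (⊤ : ℕ∞) U}

/-- The chart domain of a trumpet model is time-invariant. [folklore] -/
theorem isTimeInvariantDomain (h : IsTrumpetModel U γ) : IsTimeInvariantDomain U :=
  h.1

/-- The metric of a trumpet model is `x⁰`-stationary. [folklore] -/
theorem isStationaryInChart (h : IsTrumpetModel U γ) : IsStationaryInChart U γ :=
  h.2.1

/-- A trumpet model is vacuum: Ricci-flat for its Levi-Civita connection. [folklore] -/
theorem isRicciFlat (h : IsTrumpetModel U γ) [γ.toPseudoRiemannianMetric.HasLeviCivita] :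
    γ.toPseudoRiemannianMetric.IsRicciFlat :=
  h.2.2.1

/-- In a trumpet model `γ(∂₀, ∂₀)` is bounded above. [folklore] -/
theorem exists_val_basisVector_le (h : IsTrumpetModel U γ) :
    ∃ C : ℝ, ∀ x : U, γ.val x (E4.basisVector 0) (E4.basisVector 0) ≤ C :=
  h.2.2.2.1

/-- A trumpet model has a trumpet slab at `x⁰ = 0`. [folklore] -/
theorem exists_isTrumpetSlab (h : IsTrumpetModel U γ) :
    ∃ (V : Opens E3) (σ : V → U) (νV : NormalField 𝓘(ℝ, E4) σ) (DV : InitialDataSet (𝓡 3) V)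
      (e : AFEnd V), IsTrumpetSlab U γ V σ νV DV e :=
  h.2.2.2.2

end IsTrumpetModel

namespace IsTrumpetSlab

variable {U : Opens E4} {γ : LorentzianMetric 𝓘(ℝ, E4) (⊤ : ℕ∞) U} {V : Opens E3} {σ : V → U}
  {νV : NormalField 𝓘(ℝ, E4) σ} {DV : InitialDataSet (𝓡 3) V} {e : AFEnd V}

/-- The slab of a trumpet slab is `{y | (0, y) ∈ U}`. [folklore] -/
theorem coe_eq (h : IsTrumpetSlab U γ V σ νV DV e) :
    (V : Set E3) = {y | E4.ofTimeSpace 0 y ∈ (U : Set E4)} :=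
  h.1

/-- The slice map of a trumpet slab is `y ↦ (0, y)`. [folklore] -/
theorem coe_apply (h : IsTrumpetSlab U γ V σ νV DV e) (y : V) : (σ y : E4) = E4.ofTimeSpace 0 y :=
  h.2.1 y

/-- The normal field of a trumpet slab is a unit timelike normal. [folklore] -/
theorem isUnitNormal (h : IsTrumpetSlab U γ V σ νV DV e) :
    γ.toPseudoRiemannianMetric.IsUnitNormal (𝓡 3) σ νV (-1) :=
  h.2.2.1

/-- The metric of the data of a trumpet slab is the induced metric. [folklore] -/
theorem inner_eq (h : IsTrumpetSlab U γ V σ νV DV e) (y : V) (v w : TangentSpace (𝓡 3) y) :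
    DV.h.inner y v w =
      γ.val (σ y) (mfderiv (𝓡 3) 𝓘(ℝ, E4) σ y v) (mfderiv (𝓡 3) 𝓘(ℝ, E4) σ y w) :=
  h.2.2.2.1 y v w

/-- The `k` of a trumpet slab is the second fundamental form of the slice. [folklore] -/
theorem secondFundamentalForm_eq (h : IsTrumpetSlab U γ V σ νV DV e)
    [γ.toPseudoRiemannianMetric.HasLeviCivita] (y : V) :
    γ.toPseudoRiemannianMetric.secondFundamentalForm (𝓡 3) σ νV y = DV.kBilin y :=
  h.2.2.2.2.1 y

/-- The data of a trumpet slab are maximal. [folklore] -/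
theorem isMaximalData (h : IsTrumpetSlab U γ V σ νV DV e) : DV.IsMaximalData :=
  h.2.2.2.2.2.1

/-- The data of a trumpet slab are complete. [folklore] -/
theorem isComplete (h : IsTrumpetSlab U γ V σ νV DV e) [DV.metric.HasLeviCivita] :
    DV.IsComplete :=
  h.2.2.2.2.2.2.1

/-- The slab of a trumpet slab is diffeomorphic to `ℝ³ ∖ {0}`. [folklore] -/
theorem nonempty_diffeomorph (h : IsTrumpetSlab U γ V σ νV DV e) :
    Nonempty (Diffeomorph (𝓡 3) (𝓡 3) V ((⟨({0} : Set E3)ᶜ, isOpen_compl_singleton⟩ : Opens E3))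
      (⊤ : ℕ∞)) :=
  h.2.2.2.2.2.2.2.1

/-- The data of a trumpet slab are asymptotically flat of order `1` at the end `e`. [folklore] -/
theorem isAsymptoticallyFlat (h : IsTrumpetSlab U γ V σ νV DV e) : e.IsAsymptoticallyFlat DV 1 :=
  h.2.2.2.2.2.2.2.2.1

/-- The model lapse `-γ(∂₀, νV)` of a trumpet slab is positive. [folklore] -/
theorem lapse_pos (h : IsTrumpetSlab U γ V σ νV DV e) (y : V) :
    0 < - γ.val (σ y) (E4.basisVector 0) (νV y) :=
  h.2.2.2.2.2.2.2.2.2.1 y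

/-- The model lapse of a trumpet slab tends to `1` at the asymptotically flat end. [folklore] -/
theorem tendsto_lapse_one (h : IsTrumpetSlab U γ V σ νV DV e) :
    Tendsto (fun z : exteriorRegion e.R ↦
        - γ.val (σ (e.dataChart z)) (E4.basisVector 0) (νV (e.dataChart z)))
      (comap (fun z : exteriorRegion e.R ↦ ‖(z : E3)‖) atTop) (𝓝 1) :=
  h.2.2.2.2.2.2.2.2.2.2.1

/-- The model lapse of a trumpet slab tends to `0` off the end outside compact sets. [folklore] -/
theorem lapse_lt_of_not_mem (h : IsTrumpetSlab U γ V σ νV DV e) {ε : ℝ} (hε : 0 < ε) :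
    ∃ K : Set V, IsCompact K ∧ ∀ y : V, y ∉ K → y ∉ (e.U : Set V) →
      - γ.val (σ y) (E4.basisVector 0) (νV y) < ε :=
  h.2.2.2.2.2.2.2.2.2.2.2.1 ε hε

/-- The lapse well of a trumpet slab is causally trapped away from the world tube over the far
part of the end. [folklore] -/
theorem exists_trapped (h : IsTrumpetSlab U γ V σ νV DV e) :
    ∃ ε : ℝ, 0 < ε ∧ ∃ R' : ℝ, ∀ τU : TimeOrientation γ, (∀ y : V, τU.IsFutureDirected (νV y)) →
      ∀ y : V, - γ.val (σ y) (E4.basisVector 0) (νV y) < ε → ∀ p : U,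
        (∃ (z : V) (s : ℝ), z ∈ e.far R' ∧ (p : E4) = (σ z : E4) + s • E4.basisVector 0) →
          p ∉ γ.causalFuture τU {σ y} :=
  h.2.2.2.2.2.2.2.2.2.2.2.2

end IsTrumpetSlab

/-! ### Time-equivariant embeddings into Kerr–Schild Kerr -/

/-- `(U, γ)` **embeds time-equivariantly into Kerr–Schild Kerr with parameters `(M, a)`**: there
are a constant `c > 0` and a smooth injective map `χ : U → ℝ⁴` with values in
`{r > 0} = Kerr.region a 0`, whose range contains a horizon-penetrating region
`Kerr.region a r₁`, `r₁ < r₊(M, a)`, such that `γ = χ^* g_{M,a}` for the Kerr–Schild form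
`Kerr.bilin M a` and `χ (x + s ∂₀) = χ x + (c s) ∂₀` (the model time `x⁰` is a constant multiple
of Kerr–Schild time `t*` along `χ`). This is how a stationary trumpet slicing presents a region
`{r > r_c}` of Kerr, with `r₋ ≤ r_c ≤ r₊` for the trumpet surface (Dennison–Baumgarte–Montero
2014, the paragraph after the identification of the `R = R₀` trumpet surfaces:
`M - √(M² - a²) ≤ R₀ ≤ M`). The body is verbatim the "Kerr-embedded with these parameters"
clause of the route item `KerrTrumpetModel`. [cite: DennisonBaumgarteMontero2014, p. 261101-3] -/
def IsKerrEmbeddedStationaryWith (M a : ℝ) (U : Opens E4)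
    (γ : LorentzianMetric 𝓘(ℝ, E4) (⊤ : ℕ∞) U) : Prop :=
  ∃ c : ℝ, 0 < c ∧ ∃ χ : U → E4, ContMDiff 𝓘(ℝ, E4) 𝓘(ℝ, E4) (⊤ : ℕ∞) χ ∧ Injective χ ∧
    (∀ x, χ x ∈ (Kerr.region a 0 : Set E4)) ∧
    (∃ r₁ : ℝ, r₁ < Kerr.rPlus M a ∧ (Kerr.region a r₁ : Set E4) ⊆ range χ) ∧
    (∀ (x : U) (v w : E4), γ.val x v w =
      Kerr.bilin M a (χ x) (mfderiv 𝓘(ℝ, E4) 𝓘(ℝ, E4) χ x v) (mfderiv 𝓘(ℝ, E4) 𝓘(ℝ, E4) χ x w)) ∧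
    (∀ (x y : U) (s : ℝ), (y : E4) = (x : E4) + s • E4.basisVector 0 →
      χ y = χ x + (c * s) • E4.basisVector 0)

/-- `(U, γ)` **embeds time-equivariantly into sub-extremal Kerr–Schild Kerr**: for some
sub-extremal parameters `|a| < M`, `IsKerrEmbeddedStationaryWith M a U γ`. The body is verbatim
the conclusion of the route item `TrumpetKIDRigidity` (`isKerrEmbeddedStationary_iff`).
[cite: DennisonBaumgarteMontero2014, p. 261101-3] -/
def IsKerrEmbeddedStationary (U : Opens E4) (γ : LorentzianMetric 𝓘(ℝ, E4) (⊤ : ℕ∞) U) : Prop :=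
  ∃ (Mk ak : ℝ), Kerr.IsSubextremal Mk ak ∧ IsKerrEmbeddedStationaryWith Mk ak U γ

/-- Unfolding lemma for `IsKerrEmbeddedStationaryWith` (the inline "Kerr-embedded with these
parameters" clause of the route item `KerrTrumpetModel`). [folklore] -/
theorem isKerrEmbeddedStationaryWith_iff (Mk ak : ℝ) (U : Opens E4)
    (γ : LorentzianMetric 𝓘(ℝ, E4) (⊤ : ℕ∞) U) :
    IsKerrEmbeddedStationaryWith Mk ak U γ ↔
    ∃ c : ℝ, 0 < c ∧ ∃ χ : U → E4, ContMDiff 𝓘(ℝ, E4) 𝓘(ℝ, E4) (⊤ : ℕ∞) χ ∧ Injective χ ∧ (∀ x,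
      χ x ∈ (Kerr.region ak 0 : Set E4)) ∧ (∃ r₁ : ℝ, r₁ < Kerr.rPlus Mk ak ∧
      (Kerr.region ak r₁ : Set E4) ⊆ range χ) ∧ (∀ (x : U) (v w : E4), γ.val x v w =
      Kerr.bilin Mk ak (χ x) (mfderiv 𝓘(ℝ, E4) 𝓘(ℝ, E4) χ x v) (mfderiv 𝓘(ℝ, E4) 𝓘(ℝ, E4) χ x
      w)) ∧ (∀ (x y : U) (s : ℝ), (y : E4) = (x : E4) + s • E4.basisVector 0 → χ y = χ x + (c * s) •
      E4.basisVector 0) :=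
  Iff.rfl

/-- Unfolding lemma: `IsKerrEmbeddedStationary U γ` is, definitionally, the inline conclusion of
the route item `TrumpetKIDRigidity` (and the per-model clause of `SliceDictionary`). [folklore] -/
theorem isKerrEmbeddedStationary_iff (U : Opens E4) (γ : LorentzianMetric 𝓘(ℝ, E4) (⊤ : ℕ∞) U) :
    IsKerrEmbeddedStationary U γ ↔
    ∃ (Mk ak : ℝ), Kerr.IsSubextremal Mk ak ∧ ∃ c : ℝ, 0 < c ∧ ∃ χ : U → E4, ContMDiff 𝓘(ℝ, E4)
      𝓘(ℝ, E4) (⊤ : ℕ∞) χ ∧ Injective χ ∧ (∀ x, χ x ∈ (Kerr.region ak 0 : Set E4)) ∧ (∃ r₁ : ℝ,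
      r₁ < Kerr.rPlus Mk ak ∧ (Kerr.region ak r₁ : Set E4) ⊆ range χ) ∧ (∀ (x : U) (v w : E4),
      γ.val x v w = Kerr.bilin Mk ak (χ x) (mfderiv 𝓘(ℝ, E4) 𝓘(ℝ, E4) χ x v) (mfderiv 𝓘(ℝ, E4)
      𝓘(ℝ, E4) χ x w)) ∧ (∀ (x y : U) (s : ℝ), (y : E4) = (x : E4) + s • E4.basisVector 0 → χ y =
      χ x + (c * s) • E4.basisVector 0) :=
  Iff.rfl

/-- An embedding with sub-extremal parameters is a sub-extremal Kerr embedding. [folklore] -/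
theorem IsKerrEmbeddedStationaryWith.isKerrEmbeddedStationary {M a : ℝ} {U : Opens E4}
    {γ : LorentzianMetric 𝓘(ℝ, E4) (⊤ : ℕ∞) U} (hMa : Kerr.IsSubextremal M a)
    (h : IsKerrEmbeddedStationaryWith M a U γ) : IsKerrEmbeddedStationary U γ :=
  ⟨M, a, hMa, h⟩

end Literature.Geometry.Lorentzian
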